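import Summits.ResolutionOfSingularities.ResolutionOfSingularities.Theorems.PurelyInseparableDim4BlindFixedPoints
import HarnessLib

/-!
# BLIND FIXED POINTS OF THE POINT BLOW-UP AT EVERY EXPONENT — part 2: OUT OF COORDINATE SCOPE, headline, link
# (cell `res-dim4-pi`, ZOO board; desk WORD #136 (a) (β), seat res-dim4-p-4 g3 — «ZOO companion uniform in q»)

[OURS · ZOO / census value only · TIER-2 · counted 0 · AI kernel work, weaker than expert review.]  Continues
`…BlindFixedPoints` (`A_n = x₃(x₁ⁿ + gⁿ)`, `g = x₂ − x₄ + x₂x₄`, `s_n = (A_n, 0, {x₂})`, `step (n+1) univ x₂ (0,0,0,1) s_n = s_n`,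
the point the only permissible coordinate centre, `{s_n}` a one-state trap — every `n ≥ 1`, every field):

* §5 **OUT of coordinate scope from move 0** (`not_inCoordinateScope_A`): `J_{n+1}⁺(A_n) ≤ Q = (x₁, x₃, g)` (`A_n ∈ Q^{n+1}`,
  CJS Lemma 13.4 (3) form `PhiLine.singLocusIdeal_le_of_mem_pow`), `Q` dies under the branch `x ↦ (0, t(1+t)⁻¹, 0, t)` into
  `K⟦t⟧` while `x₂, x₄` do not, and `D^{(e₃)}A_n (0,0,0,1) = (−1)ⁿ ≠ 0` — res-dim4-p-3's ring-map criterion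
  `IsolationCert.not_inCoordinateScope_of_ringHom`; so the loop is blind along the regular non-coordinate curve `V(x₁, x₃, g)`
  and NOT isolated (`not_isIsolated_A`);
* §6 headline **`exists_blind_fixedPoint (K) (hq : 2 ≤ q)`**, rule form `exists_constant_blind_branch`, and the link
  `s_two_eq_selfRep33`: `n = 2`, `K = 𝔽₃` is eng-w5 g2's specimen of `…ZooCertSelfReproducing33` (p690771).

Nothing here is a statement about F4-C (`TerminatesInScope`), and nothing here proves or refutes resolution of singularities in
dimension `≥ 4` / characteristic `p`; `¬ TerminatesSomeRule p p` / `¬ Terminates1h p p` are the coordinate cage's and are not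
restated.  bears_on: LADDER-RESOLUTION:D157-DOOR2 (res-dim4-pi · ZOO companion uniform in q, part 2).  Supports
stmt-ResolutionOfSingularities-16155 (helper).
-/

set_option linter.dupNamespace false

open MvPolynomial Finset

open scoped BigOperators

noncomputable section

namespace Summit.ResolutionOfSingularities.ResolutionOfSingularities.Theorems.PIDim4

namespace BlindFixedPoint

open Literature.AlgebraicGeometry.Resolution
open Literature.AlgebraicGeometry.Resolution.Hauser2010
open Literature.AlgebraicGeometry.Resolution.CentreBlowup

variable {K : Type} [Field K] [DecidableEq K]

/-! ## §5 Out of coordinate scope -/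

omit [DecidableEq K] in
/-- **`A_n` is OUT of coordinate scope** (`n ≥ 1`): the regular non-coordinate curve `V(x₁, x₃, g)` through the origin lies in
the `(n+1)`-fold locus of `z^{n+1} + A_n`. [folklore] -/
theorem not_inCoordinateScope_A {n : ℕ} (hn : 1 ≤ n) : ¬ InCoordinateScope (n + 1) (A K n) := by
  classical
  -- the branch `t ↦ (0, t(1+t)⁻¹, 0, t)` in `K⟦t⟧`
  let u : PowerSeries K := (1 + PowerSeries.X)⁻¹
  have hu : (1 + PowerSeries.X : PowerSeries K) * u = 1 := PowerSeries.mul_inv_cancel _ (by simp)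
  let c : Fin 4 → PowerSeries K := ![0, PowerSeries.X * u, 0, PowerSeries.X]
  have hc0 : c 0 = 0 := rfl
  have hc1 : c 1 = PowerSeries.X * u := rfl
  have hc2 : c 2 = 0 := rfl
  have hc3 : c 3 = PowerSeries.X := rfl
  have hc : ∀ k, PowerSeries.constantCoeff (c k) = 0 := by
    intro k; fin_cases k <;> simp [c]
  have hφg : MvPolynomial.aeval c (g K) = 0 := by
    simp only [g, map_add, map_sub, map_mul, MvPolynomial.aeval_X, hc1, hc3]
    linear_combination (PowerSeries.X : PowerSeries K) * hu
  have hφQ : Q K ≤ RingHom.ker (MvPolynomial.aeval c).toRingHom := by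
    unfold Q
    rw [Ideal.span_le]
    intro x hx
    simp only [Set.mem_insert_iff, Set.mem_singleton_iff] at hx
    rcases hx with rfl | rfl | rfl
    · simp [RingHom.mem_ker, hc0]
    · simp [RingHom.mem_ker, hc2]
    · exact (RingHom.mem_ker).mpr hφg
  have hdeg : (Finsupp.single (2 : Fin 4) 1 : Fin 4 →₀ ℕ).degree = 1 := by
    rw [Finsupp.degree_single]
  refine IsolationCert.not_inCoordinateScope_of_ringHom (MvPolynomial.aeval c).toRingHom (fun α h0 hq => ?_)
    (fun G hG => ?_) ({0, 2} : Finset (Fin 4)) (fun i hi => ?_) (Finsupp.single 2 1) (by rw [hdeg]; exact one_pos)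
    (by rw [hdeg]; omega) (b K) (fun i hi => ?_) ?_
  · -- `J⁺ ≤ Q ≤ ker φ`
    have hJ : hasseDeriv α (A K n) ∈ singLocusIdeal (n + 1) (A K n) := Ideal.subset_span ⟨α, h0, hq, rfl⟩
    exact hφQ (PhiLine.singLocusIdeal_le_of_mem_pow le_rfl (A_mem_Q_pow n) hJ)
  · -- `ker φ ≤ 𝔪₀`
    rw [← IsolationCert.constantCoeff_aeval_curve c hc G]
    change PowerSeries.constantCoeff ((MvPolynomial.aeval c).toRingHom G) = 0
    rw [hG, map_zero]
  · -- `x₂, x₄` survive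
    have hX : (PowerSeries.X : PowerSeries K) ≠ 0 := PowerSeries.X_ne_zero
    have hune : u ≠ 0 := fun h0 => by rw [h0, mul_zero] at hu; exact zero_ne_one hu
    change MvPolynomial.aeval c (X i) ≠ 0
    rw [MvPolynomial.aeval_X]
    fin_cases i
    · exact absurd (by simp) hi
    · exact mul_ne_zero hX hune
    · exact absurd (by simp) hi
    · exact hX
  · simp only [Finset.mem_insert, Finset.mem_singleton] at hi
    rcases hi with rfl | rfl <;> rfl
  · -- the witness `D^{(e₃)} A_n (0,0,0,1) = (−1)ⁿ`
    rw [IsolationCert.hasseDeriv_single_one, A, pderiv_mul]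
    simp [g, b, eval_X]
    rw [zero_pow (by omega), zero_add]
    exact pow_ne_zero _ (neg_ne_zero.mpr one_ne_zero)

omit [DecidableEq K] in
/-- … hence not isolated either. [folklore] -/
theorem not_isIsolated_A {n : ℕ} (hn : 1 ≤ n) : ¬ IsIsolated (n + 1) (A K n) :=
  fun h => not_inCoordinateScope_A hn (IsolatedScope.inCoordinateScope_of_isIsolated h)

/-! ## §6 Headlines -/

variable (K) in
/-- **BLIND FIXED POINTS OF THE POINT BLOW-UP AT EVERY EXPONENT `q ≥ 2`, OVER EVERY FIELD.**  The state
`(x₃(x₁^{q−1} + (x₂ − x₄ + x₂x₄)^{q−1}), 0, {x₂})` returns LETTER FOR LETTER under the point blow-up (`x₂`-chart, fibre point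
`(0,0,0,1)`), the point being its only permissible coordinate centre — so the loop is a `Step0` and a `Step1h` edge and `{s}` a
one-state trap — and it is OUT of coordinate scope and not isolated.  ZOO / census value only (TIER-2: blind from move 0);
nothing about F4-C. [OURS · counted 0] [folklore] -/
theorem exists_blind_fixedPoint {q : ℕ} (hq : 2 ≤ q) :
    ∃ (s : State K) (b : Fin 4 → K), CentreBlowup.step q Finset.univ 1 b s = s ∧ Step0 q s s ∧ Step1h q s s ∧
      (∀ S, IsPermissibleCentre q S s.F → S = Finset.univ) ∧ IsTrap q ({s} : Set (State K)) ∧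
        ¬ InCoordinateScope q s.F ∧ ¬ IsIsolated q s.F := by
  obtain ⟨n, rfl⟩ : ∃ n, q = n + 1 := ⟨q - 1, by omega⟩
  have hn : 1 ≤ n := by omega
  exact ⟨s K n, b K, step_s hn, step0_s hn, step1h_s hn, fun S hS => eq_univ_of_isPermissibleCentre hn hS,
    isTrap_singleton hn, not_inCoordinateScope_A hn, not_isIsolated_A hn⟩

variable (K) in
/-- Rule form: at every exponent `q ≥ 2`, over every field, EVERY permissible coordinate rule has a constant infinite branch all of
whose states are out of coordinate scope. [folklore] -/
theorem exists_constant_blind_branch {q : ℕ} (hq : 2 ≤ q) (R : CentreRule K) (hR : IsPermissibleRule q R) :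
    ∃ c : ℕ → State K, (∀ k, StepRule q R (c k) (c (k + 1))) ∧ ∀ k, ¬ InCoordinateScope q (c k).F := by
  obtain ⟨n, rfl⟩ : ∃ n, q = n + 1 := ⟨q - 1, by omega⟩
  have hn : 1 ≤ n := by omega
  exact ⟨fun _ => s K n, fun _ => stepRule_s hn R hR, fun _ => not_inCoordinateScope_A hn⟩

omit [DecidableEq K] in
/-- **Link with the `(3,3)` specimen**: `s_2` over `𝔽₃` is eng-w5's state of `…ZooCertSelfReproducing33`. [folklore] -/
theorem s_two_eq_selfRep33 : s (ZMod 3) 2 = ZooCert.SelfRep33.s.toState := by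
  have hF : A (ZMod 3) 2 = StepKit.evalT ZooCert.SelfRep33.L := by
    rw [ZooCert.SelfRep33.evalT_L]; rfl
  have hr : (0 : Fin 4 →₀ ℕ) = StepKit.expo ![0, 0, 0, 0] := by
    rw [eq_comm, StepKit.expo_eq_zero_iff]; funext i; fin_cases i <;> rfl
  rw [s, hF, hr]; rfl

end BlindFixedPoint

end Summit.ResolutionOfSingularities.ResolutionOfSingularities.Theorems.PIDim4

end
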